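import Summits.Parity.GeneralizedHardyLittlewood.Theorems.LeeYangFibresAbsoluteUpgradeSinglesDecaySeq
import Summits.Parity.GeneralizedHardyLittlewood.Theorems.LeeYangFibresAbsoluteUpgradeSinglesDecayAP
import Summits.Parity.GeneralizedHardyLittlewood.Theorems.LeeYangFibresAbsoluteUpgradeSinglesDecayWeights
import HarnessLib

/-!
# Route `LeeYangFibres`, crux `AbsoluteUpgrade` (stmt-Parity-14116), line `nlc-cells-absolute-clip`:
# helper file 5 for the stub `stub_singlesDecay` — the remainder sum: Liouville class sums along a
# form, averaged over squarefree moduli with root-count weights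

**`classSums_le`.** For `B, t` there are `C, x₀` such that for `x ≥ x₀`, every `F ∈ ℤ[X]` with
`ω_F(p) ≤ B` at all primes, every form `a m + b` (`a ≠ 0`) which is `≥ 1` and `≤ x` on an integer
interval `[m₁, m₂]`, and every `D` with `|a| D ≤ x^{1/4}`,

  `∑_{d ≤ D squarefree} ∑_{s mod d, d ∣ F(s)} (1 + |∑_{m ∈ [m₁,m₂], m ≡ s (d)} λ(a m + b)|) ≤ C x/(log x)^{t+3}`.

Proof: the inner sum is a `λ`-sum over the class `a s + b (mod |a| d)` in ONE value interval
`(V₁, V₂] ⊆ (0, x]` (`exists_value_interval`, from helper file 2); per modulus keep the worst of the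
`ω_F(d) ≤ B^{ω(d)}` classes (`M_d`), so the double sum is `≤ ∑_d ω_F(d) M_d`; Cauchy–Schwarz,
`∑_d ω_F(d)² M_d ≤ 2x ∑_{d ≤ D} B^{2ω(d)}/d ≪ x (log x)^{2B²}` (trivial bound `M_d ≤ x/d + 1`, helper
file 4) and `∑_d M_d ≪_A x/(log x)^A` with `A = 2B² + 2t + 6` (Bombieri–Vinogradov for `λ` over
intervals, all residues: `bv_intervals`, helper file 2, moduli `q = |a| d ≤ x^{1/4}`); the `+1`'s give
`∑_{d ≤ D} B^{ω(d)} ≪ D (log x)^{2B} ≤ x^{1/4}(log x)^{2B}`.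

References: H. Halberstam, H.-E. Richert, *Sieve Methods* (1974), Ch. 2 and §5.7 (the `k^{ω(d)}`
weights and Cauchy–Schwarz) [HalberstamRichert1974]; H. Iwaniec, E. Kowalski, *Analytic Number
Theory* (2004), Thm. 17.4 [IwaniecKowalski2004].
-/

noncomputable section

open Finset ArithmeticFunction Polynomial
open scoped ArithmeticFunction.omega

namespace Summit.Parity.GeneralizedHardyLittlewood.Theorems.AbsoluteUpgrade

open Literature.NumberTheory.Sieve
open Literature.NumberTheory.Sieve.BVMoebius (eventually_log_rpow_le_rpow')

/-! ### One value interval for all classes -/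

/-- **Class sums along a form are class sums of values over one interval.** For `a ≠ 0` and a form
`a m + b ≥ 1` on the non-empty integer interval `[m₁, m₂]` there are `V₁ ≤ V₂`, `V₂` a value of the form
on `[m₁, m₂]`, such that for every modulus `d ≥ 1` and residue `s`,
`∑_{m ∈ [m₁,m₂], m ≡ s (d)} f(a m + b) = ∑_{V₁ < v ≤ V₂, v ≡ a s + b (|a| d)} f(v)` (`a < 0` is reduced
to `a > 0` by `m ↦ −m`). [folklore] -/
theorem exists_value_interval {a b m₁ m₂ : ℤ} (ha : a ≠ 0) (hm : m₁ ≤ m₂)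
    (hpos : ∀ m ∈ Icc m₁ m₂, 1 ≤ a * m + b) :
    ∃ V₁ V₂ : ℕ, V₁ ≤ V₂ ∧ (∃ m ∈ Icc m₁ m₂, (V₂ : ℤ) = a * m + b) ∧
      ∀ d : ℕ, 0 < d → ∀ (s : ℤ) (f : ℕ → ℝ),
        ∑ m ∈ (Icc m₁ m₂).filter (fun m : ℤ => m ≡ s [ZMOD d]), f (a * m + b).toNat =
          ∑ v ∈ (Ioc V₁ V₂).filter
            (fun v : ℕ => (v : ℤ) ≡ a * s + b [ZMOD ((a.natAbs * d : ℕ) : ℤ)]), f v := by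
  have hm₁ : m₁ ∈ Icc m₁ m₂ := Finset.mem_Icc.mpr ⟨le_rfl, hm⟩
  have hm₂ : m₂ ∈ Icc m₁ m₂ := Finset.mem_Icc.mpr ⟨hm, le_rfl⟩
  rcases lt_or_gt_of_ne ha with hneg | hpos'
  · -- `a < 0`: reflect
    set a' := -a with ha'
    have ha'0 : 0 < a' := by rw [ha']; linarith
    have haa : (a.natAbs : ℤ) = a' := by
      rw [ha']
      have := Int.natAbs_neg a
      rw [← this, Int.natAbs_of_nonneg (by linarith)]
    have hp1 : 0 < a' * (-m₂) + b := by have := hpos m₂ hm₂; rw [ha']; linarith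
    refine ⟨(a' * (-m₂ - 1) + b).toNat, (a' * (-m₁) + b).toNat, Int.toNat_le_toNat (by nlinarith),
      ⟨m₁, hm₁, ?_⟩, fun d hd s f => ?_⟩
    · rw [Int.toNat_of_nonneg (by have := hpos m₁ hm₁; rw [ha']; linarith), ha']
      ring
    · have hd' : (0 : ℤ) < d := by exact_mod_cast hd
      rw [sum_filter_Icc_modEq_neg a b m₁ m₂ s d (fun z => f z.toNat)]
      have h := sum_filter_Icc_modEq_eq ha'0 hd' hp1 (-m₁) (-s) f
      have e1 : ∀ m : ℤ, -a * m + b = a' * m + b := fun m => by rw [ha']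
      simp only [e1]
      rw [h]
      refine Finset.sum_congr ?_ fun _ _ => rfl
      refine Finset.filter_congr fun v _ => ?_
      rw [Nat.cast_mul, haa, show a' * -s + b = a * s + b by rw [ha']; ring]
  · -- `a > 0`
    have haa : (a.natAbs : ℤ) = a := Int.natAbs_of_nonneg hpos'.le
    have hp1 : 0 < a * m₁ + b := by have := hpos m₁ hm₁; linarith
    refine ⟨(a * (m₁ - 1) + b).toNat, (a * m₂ + b).toNat, Int.toNat_le_toNat (by nlinarith),
      ⟨m₂, hm₂, ?_⟩, fun d hd s f => ?_⟩
    · rw [Int.toNat_of_nonneg (by have := hpos m₂ hm₂; linarith)]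
    · have hd' : (0 : ℤ) < d := by exact_mod_cast hd
      rw [sum_filter_Icc_modEq_eq hpos' hd' hp1 m₂ s f]
      refine Finset.sum_congr ?_ fun _ _ => rfl
      refine Finset.filter_congr fun v _ => ?_
      rw [Nat.cast_mul, haa]

/-! ### The remainder sum -/

/-- `exp(c log L) = L^c`-type identity: `exp (n * log L) = L ^ n` for `L > 0`. [folklore] -/
theorem exp_natMul_log {L : ℝ} (hL : 0 < L) (n : ℕ) : Real.exp (n * Real.log L) = L ^ n := by
  rw [← Real.rpow_natCast, Real.rpow_def_of_pos hL, mul_comm]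

set_option maxHeartbeats 800000 in
/-- **The remainder sum: class sums of `λ` along a form, averaged over squarefree moduli with
root-count weights.**  For `B, t` there are `C, x₀` with: for `x ≥ x₀`, `F ∈ ℤ[X]` with `ω_F(p) ≤ B` at
all primes, a form `a m + b` (`a ≠ 0`) with `1 ≤ a m + b ≤ x` on the integer interval `[m₁, m₂]`
(`m₁ ≤ m₂`), and `|a| D ≤ x^{1/4}`,
`∑_{d ≤ D squarefree} ∑_{s mod d, d ∣ F(s)} (1 + |∑_{m ∈ [m₁,m₂], m ≡ s (d)} λ(a m + b)|) ≤ C x/(log x)^{t+3}`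
(worst class per modulus, `ω_F(d) ≤ B^{ω(d)}`, Cauchy–Schwarz, and Bombieri–Vinogradov for `λ` over
intervals with all residues, `bv_intervals`). [cite: HalberstamRichert1974, Ch. 2 §5.7] -/
theorem classSums_le : ∀ (B t : ℕ), ∃ C x₀ : ℝ, ∀ x : ℝ, x₀ ≤ x → ∀ F : Polynomial ℤ, (∀ p : ℕ, p.Prime → polyRootCountMod ![F] p ≤ B) → ∀ (a b m₁ m₂ : ℤ), a ≠ 0 → m₁ ≤ m₂ → (∀ m ∈ Icc m₁ m₂, 1 ≤ a * m + b) → (∀ m ∈ Icc m₁ m₂, ((a * m + b : ℤ) : ℝ) ≤ x) → ∀ Dn : ℕ, ((a.natAbs * Dn : ℕ) : ℝ) ≤ x ^ (1 / 4 : ℝ) → ∑ d ∈ (Icc 1 Dn).filter Squarefree, ∑ s ∈ rootsMod F d, (1 + |∑ m ∈ (Icc m₁ m₂).filter (fun m : ℤ => m ≡ (s : ℤ) [ZMOD d]), (liouville (a * m + b).toNat : ℝ)|) ≤ C * x / Real.log x ^ (t + 3) := by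
  intro B t
  -- constants
  obtain ⟨A, hA⟩ : ∃ A : ℕ, A = 2 * B ^ 2 + 2 * t + 6 := ⟨_, rfl⟩
  obtain ⟨Cbv, x₀, hbv⟩ := bv_intervals (1 / 4) (by norm_num) (A : ℝ)
    (by rw [hA]; positivity)
  set Cb : ℝ := max Cbv 0 with hCb
  have hCb0 : 0 ≤ Cb := le_max_right _ _
  set c₀ : ℝ := Real.sqrt (2 * Real.exp (10 * (B : ℝ) ^ 2) * Cb) with hc₀
  have hc₀0 : 0 ≤ c₀ := Real.sqrt_nonneg _
  obtain ⟨x₁, hx₁⟩ := Filter.eventually_atTop.1 ((Filter.eventually_ge_atTop x₀).and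
    ((Filter.eventually_ge_atTop (max 16 (16 * Real.exp (40 * B)))).and
      (eventually_log_rpow_le_rpow' ((2 * B + t + 3 : ℕ) : ℝ) (by norm_num : (0 : ℝ) < 1 / 2))))
  refine ⟨c₀ + 1, x₁, fun x hx F hF a b m₁ m₂ ha hm hpos hlex Dn hDn => ?_⟩
  obtain ⟨hxx₀, hx16, hlogle⟩ := hx₁ x hx
  have hx16' : (16 : ℝ) ≤ x := le_trans (le_max_left _ _) hx16
  have hxe : 16 * Real.exp (40 * B) ≤ x := le_trans (le_max_right _ _) hx16
  have hx0 : 0 < x := by linarith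
  have hx1 : 1 ≤ x := by linarith
  set L := Real.log x with hL
  have hL1 : 1 ≤ L := by
    rw [hL, Real.le_log_iff_exp_le hx0]
    have := Real.exp_one_lt_d9
    linarith
  have hL0 : 0 < L := by linarith
  -- the data of the form
  set α : ℕ := a.natAbs with hα
  have hα1 : 1 ≤ α := Int.natAbs_pos.mpr ha
  have hα0 : (0 : ℝ) < α := by exact_mod_cast hα1
  obtain ⟨V₁, V₂, hV, ⟨mstar, hmstar, hV₂⟩, hLam⟩ := exists_value_interval ha hm hpos
  have hV₂x : ((V₂ : ℕ) : ℝ) ≤ x := by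
    have h1 := hlex mstar hmstar
    rw [← hV₂] at h1
    exact_mod_cast h1
  -- the level
  have hDnx4 : ((Dn : ℕ) : ℝ) ≤ x ^ (1 / 4 : ℝ) := by
    refine le_trans ?_ hDn
    have : Dn ≤ α * Dn := Nat.le_mul_of_pos_left Dn hα1
    exact_mod_cast this
  have hx4x : x ^ (1 / 4 : ℝ) ≤ x := by
    conv_rhs => rw [← Real.rpow_one x]
    exact Real.rpow_le_rpow_of_exponent_le hx1 (by norm_num)
  have hDnx : ((Dn : ℕ) : ℝ) ≤ x := hDnx4.trans hx4x
  set 𝒟 := (Icc 1 Dn).filter Squarefree with h𝒟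
  have hmem𝒟 : ∀ d ∈ 𝒟, 1 ≤ d ∧ d ≤ Dn ∧ Squarefree d := fun d hd => by
    rw [h𝒟, Finset.mem_filter, Finset.mem_Icc] at hd
    exact ⟨hd.1.1, hd.1.2, hd.2⟩
  -- the class sums
  set Lam : ℕ → ℕ → ℝ := fun d s => ∑ m ∈ (Icc m₁ m₂).filter (fun m : ℤ => m ≡ (s : ℤ) [ZMOD d]),
    (liouville (a * m + b).toNat : ℝ) with hLamdef
  set ρ : ℕ → ℝ := fun d => (polyRootCountMod ![F] d : ℝ) with hρ
  have hρ0 : ∀ d, 0 ≤ ρ d := fun d => Nat.cast_nonneg _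
  -- worst class per modulus
  have hsel : ∀ d : ℕ, ∃ s : ℕ, ∑ s' ∈ rootsMod F d, |Lam d s'| ≤ ρ d * |Lam d s| := fun d => by
    obtain ⟨s, hs⟩ := exists_sum_le_card_mul (rootsMod F d) (fun s' => |Lam d s'|)
    rw [card_rootsMod] at hs
    exact ⟨s, hs⟩
  choose sst hsst using hsel
  set M : ℕ → ℝ := fun d => |Lam d (sst d)| with hM
  have hM0 : ∀ d, 0 ≤ M d := fun d => abs_nonneg _
  -- `M_d` as a value class sum
  have hMval : ∀ d ∈ 𝒟, M d = |∑ v ∈ (Ioc V₁ V₂).filter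
      (fun v : ℕ => (v : ℤ) ≡ a * (sst d) + b [ZMOD ((α * d : ℕ) : ℤ)]), (liouville v : ℝ)| := by
    intro d hd
    have hd0 : 0 < d := (hmem𝒟 d hd).1
    simp only [hM, hLamdef]
    rw [hLam d hd0 (sst d) (fun v => (liouville v : ℝ))]
  -- (II) trivial bound `M_d ≤ 2x/d`
  have hMtriv : ∀ d ∈ 𝒟, M d ≤ 2 * x / d := by
    intro d hd
    obtain ⟨hd1, hdD, -⟩ := hmem𝒟 d hd
    have hd0 : (0 : ℝ) < d := by exact_mod_cast hd1
    have hq : 0 < α * d := Nat.mul_pos hα1 hd1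
    rw [hMval d hd]
    have hcard := card_filter_Ioc_intModEq_le hq (a * (sst d) + b) hV
    have hxd : 1 ≤ x / d := by
      rw [le_div_iff₀ hd0, one_mul]
      exact le_trans (by exact_mod_cast hdD) hDnx
    calc |∑ v ∈ (Ioc V₁ V₂).filter
            (fun v : ℕ => (v : ℤ) ≡ a * (sst d) + b [ZMOD ((α * d : ℕ) : ℤ)]), (liouville v : ℝ)|
        ≤ ∑ v ∈ (Ioc V₁ V₂).filter
            (fun v : ℕ => (v : ℤ) ≡ a * (sst d) + b [ZMOD ((α * d : ℕ) : ℤ)]), |(liouville v : ℝ)| :=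
          Finset.abs_sum_le_sum_abs _ _
      _ ≤ ∑ _v ∈ (Ioc V₁ V₂).filter
            (fun v : ℕ => (v : ℤ) ≡ a * (sst d) + b [ZMOD ((α * d : ℕ) : ℤ)]), (1 : ℝ) :=
          Finset.sum_le_sum fun v _ => abs_liouville_le_one v
      _ = #((Ioc V₁ V₂).filter
            (fun v : ℕ => (v : ℤ) ≡ a * (sst d) + b [ZMOD ((α * d : ℕ) : ℤ)])) := by simp
      _ ≤ (((V₂ : ℕ) : ℝ) - V₁) / ((α * d : ℕ) : ℝ) + 1 := hcard
      _ ≤ x / d + x / d := by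
          refine add_le_add ?_ hxd
          rw [Nat.cast_mul]
          calc (((V₂ : ℕ) : ℝ) - V₁) / ((α : ℝ) * d) ≤ x / ((α : ℝ) * d) :=
                div_le_div_of_nonneg_right (by linarith [Nat.cast_nonneg (α := ℝ) V₁]) (by positivity)
            _ ≤ x / d := by
                rw [div_le_div_iff₀ (by positivity) hd0]
                have : (d : ℝ) ≤ α * d := le_mul_of_one_le_left hd0.le (by exact_mod_cast hα1)
                nlinarith
      _ = 2 * x / d := by ring
  -- (II') the weighted trivial sum
  set Dn' : ℕ := max Dn 2 with hDn'
  have hDn'2 : 2 ≤ Dn' := le_max_right _ _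
  have hDn'x : ((Dn' : ℕ) : ℝ) ≤ x := by
    rw [hDn']
    rcases le_total Dn 2 with h | h
    · rw [max_eq_right h]; norm_num; linarith
    · rw [max_eq_left h]; exact hDnx
  have hsub𝒟 : 𝒟 ⊆ Icc 1 Dn' := fun d hd => by
    obtain ⟨hd1, hdD, -⟩ := hmem𝒟 d hd
    exact Finset.mem_Icc.mpr ⟨hd1, hdD.trans (le_max_left _ _)⟩
  have hloglog : Real.log (Real.log Dn') ≤ Real.log L := by
    have h2 : (2 : ℝ) ≤ Dn' := by exact_mod_cast hDn'2
    have hlogD : 0 < Real.log Dn' := Real.log_pos (by linarith)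
    exact Real.log_le_log hlogD (Real.log_le_log (by linarith) hDn'x)
  have hexpw : ∀ c : ℝ, 0 ≤ c → Real.exp (2 * c * (Real.log (Real.log Dn') + 5)) ≤
      Real.exp (10 * c) * Real.exp (2 * c * Real.log L) := by
    intro c hc
    rw [← Real.exp_add]
    refine Real.exp_le_exp.mpr ?_
    have := mul_le_mul_of_nonneg_left hloglog (by positivity : (0 : ℝ) ≤ 2 * c)
    nlinarith
  have hρB : ∀ d ∈ 𝒟, ρ d ≤ (B : ℝ) ^ ω d := fun d hd =>
    rootCount_le_pow_omega hF (hmem𝒟 d hd).2.2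
  have hII : ∑ d ∈ 𝒟, ρ d ^ 2 * M d ≤ 2 * x * (Real.exp (10 * (B : ℝ) ^ 2) * L ^ (2 * B ^ 2)) := by
    have hLpow : Real.exp (2 * (B : ℝ) ^ 2 * Real.log L) = L ^ (2 * B ^ 2) := by
      rw [← exp_natMul_log hL0]; congr 1; push_cast; ring
    calc ∑ d ∈ 𝒟, ρ d ^ 2 * M d ≤ ∑ d ∈ 𝒟, 2 * x * (((B : ℝ) ^ 2) ^ ω d / d) := by
          refine Finset.sum_le_sum fun d hd => ?_
          have hd0 : (0 : ℝ) < d := by exact_mod_cast (hmem𝒟 d hd).1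
          calc ρ d ^ 2 * M d ≤ ((B : ℝ) ^ ω d) ^ 2 * (2 * x / d) :=
                mul_le_mul (pow_le_pow_left₀ (hρ0 d) (hρB d hd) 2) (hMtriv d hd) (hM0 d) (by positivity)
            _ = 2 * x * (((B : ℝ) ^ 2) ^ ω d / d) := by rw [← pow_mul, mul_comm (ω d) 2, pow_mul]; ring
      _ = 2 * x * ∑ d ∈ 𝒟, ((B : ℝ) ^ 2) ^ ω d / d := by rw [Finset.mul_sum]
      _ ≤ 2 * x * ∑ d ∈ Icc 1 Dn', ((B : ℝ) ^ 2) ^ ω d / d := by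
          refine mul_le_mul_of_nonneg_left ?_ (by positivity)
          exact Finset.sum_le_sum_of_subset_of_nonneg hsub𝒟 fun d _ _ => by positivity
      _ ≤ 2 * x * Real.exp (2 * (B : ℝ) ^ 2 * (Real.log (Real.log Dn') + 5)) :=
          mul_le_mul_of_nonneg_left (sum_pow_omega_div_le (by positivity) hDn'2) (by positivity)
      _ ≤ 2 * x * (Real.exp (10 * (B : ℝ) ^ 2) * Real.exp (2 * (B : ℝ) ^ 2 * Real.log L)) :=
          mul_le_mul_of_nonneg_left (hexpw _ (by positivity)) (by positivity)
      _ = 2 * x * (Real.exp (10 * (B : ℝ) ^ 2) * L ^ (2 * B ^ 2)) := by rw [hLpow]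
  -- (I) Bombieri–Vinogradov for the worst classes
  set Pq : ℕ → Prop := fun q => α ∣ q ∧ q / α ∈ 𝒟 with hPq
  set r : ℕ → ℤ := fun q => a * (sst (q / α)) + b with hr
  set W₁ : ℕ → ℕ := fun q => if Pq q then V₁ else 0 with hW₁
  set W₂ : ℕ → ℕ := fun q => if Pq q then V₂ else 0 with hW₂
  have hW : ∀ q, W₁ q ≤ W₂ q := fun q => by
    simp only [hW₁, hW₂]; split_ifs <;> omega
  have hWx : ∀ q, ((W₂ q : ℕ) : ℝ) ≤ x := fun q => by
    simp only [hW₂]; split_ifs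
    · exact hV₂x
    · simp only [Nat.cast_zero]; exact hx0.le
  set T : ℕ → ℝ := fun q => |∑ v ∈ (Ioc (W₁ q) (W₂ q)).filter
    (fun v : ℕ => (v : ℤ) ≡ r q [ZMOD q]), (liouville v : ℝ)| with hT
  have hT0 : ∀ q, 0 ≤ T q := fun q => abs_nonneg _
  have hTM : ∀ d ∈ 𝒟, T (α * d) = M d := by
    intro d hd
    have hP : Pq (α * d) := by
      refine ⟨Dvd.intro d rfl, ?_⟩
      rw [Nat.mul_div_cancel_left d hα1]
      exact hd
    simp only [hT, hW₁, hW₂, hr, if_pos hP]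
    rw [Nat.mul_div_cancel_left d hα1, hMval d hd]
  have hBVsum := hbv x hxx₀ r W₁ W₂ hW hWx
  have hexp14 : (1 / 2 - 1 / 4 : ℝ) = 1 / 4 := by norm_num
  rw [hexp14] at hBVsum
  set Q := ⌊x ^ (1 / 4 : ℝ)⌋₊ with hQ
  have himg : 𝒟.image (fun d => α * d) ⊆ Icc 1 Q := by
    intro q hq
    obtain ⟨d, hd, rfl⟩ := Finset.mem_image.mp hq
    obtain ⟨hd1, hdD, -⟩ := hmem𝒟 d hd
    refine Finset.mem_Icc.mpr ⟨Nat.mul_pos hα1 hd1, Nat.le_floor ?_⟩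
    calc ((α * d : ℕ) : ℝ) ≤ ((α * Dn : ℕ) : ℝ) := by exact_mod_cast Nat.mul_le_mul_left α hdD
      _ ≤ x ^ (1 / 4 : ℝ) := hDn
  have hI : ∑ d ∈ 𝒟, M d ≤ Cb * x / L ^ A := by
    have hinj : Set.InjOn (fun d => α * d) ↑𝒟 := fun d₁ _ d₂ _ h =>
      Nat.eq_of_mul_eq_mul_left hα1 h
    calc ∑ d ∈ 𝒟, M d = ∑ d ∈ 𝒟, T (α * d) := Finset.sum_congr rfl fun d hd => (hTM d hd).symm
      _ = ∑ q ∈ 𝒟.image (fun d => α * d), T q := (Finset.sum_image hinj).symm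
      _ ≤ ∑ q ∈ Icc 1 Q, T q := Finset.sum_le_sum_of_subset_of_nonneg himg fun q _ _ => hT0 q
      _ ≤ Cbv * x / L ^ (A : ℝ) := hBVsum
      _ ≤ Cb * x / L ^ A := by
          rw [Real.rpow_natCast]
          exact div_le_div_of_nonneg_right (mul_le_mul_of_nonneg_right (le_max_left _ _) hx0.le)
            (by positivity)
  -- (III) Cauchy–Schwarz
  have hIII : ∑ d ∈ 𝒟, ρ d * M d ≤ c₀ * x / L ^ (t + 3) := by
    have hCS := Finset.sum_mul_sq_le_sq_mul_sq 𝒟 (fun d => ρ d * Real.sqrt (M d))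
      (fun d => Real.sqrt (M d))
    have e1 : ∀ d ∈ 𝒟, ρ d * Real.sqrt (M d) * Real.sqrt (M d) = ρ d * M d := fun d _ => by
      rw [mul_assoc, Real.mul_self_sqrt (hM0 d)]
    have e2 : ∀ d ∈ 𝒟, (ρ d * Real.sqrt (M d)) ^ 2 = ρ d ^ 2 * M d := fun d _ => by
      rw [mul_pow, Real.sq_sqrt (hM0 d)]
    have e3 : ∀ d ∈ 𝒟, Real.sqrt (M d) ^ 2 = M d := fun d _ => Real.sq_sqrt (hM0 d)
    rw [Finset.sum_congr rfl e1, Finset.sum_congr rfl e2, Finset.sum_congr rfl e3] at hCS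
    have hK : (∑ d ∈ 𝒟, ρ d * M d) ^ 2 ≤ (c₀ * x / L ^ (t + 3)) ^ 2 := by
      calc (∑ d ∈ 𝒟, ρ d * M d) ^ 2 ≤ (∑ d ∈ 𝒟, ρ d ^ 2 * M d) * ∑ d ∈ 𝒟, M d := hCS
        _ ≤ (2 * x * (Real.exp (10 * (B : ℝ) ^ 2) * L ^ (2 * B ^ 2))) * (Cb * x / L ^ A) :=
            mul_le_mul hII hI (Finset.sum_nonneg fun d _ => hM0 d) (by positivity)
        _ = (c₀ * x / L ^ (t + 3)) ^ 2 := by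
            rw [hc₀, div_pow, mul_pow, Real.sq_sqrt (by positivity), hA]
            have hLA : L ^ (2 * B ^ 2 + 2 * t + 6) = L ^ (2 * B ^ 2) * (L ^ (t + 3)) ^ 2 := by
              rw [← pow_mul, ← pow_add]; congr 1; ring
            rw [hLA]
            field_simp
    have hpos' : 0 ≤ c₀ * x / L ^ (t + 3) := by positivity
    exact (abs_le_of_sq_le_sq' hK hpos').2
  -- (IV) the `+1` terms
  have hIV : ∑ d ∈ 𝒟, ρ d ≤ x / L ^ (t + 3) := by
    have hLpow : Real.exp (2 * (B : ℝ) * Real.log L) = L ^ (2 * B) := by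
      rw [← exp_natMul_log hL0]; congr 1; push_cast; ring
    have h1 : ∑ d ∈ 𝒟, ρ d ≤ ((Dn' : ℕ) : ℝ) * (Real.exp (10 * B) * L ^ (2 * B)) := by
      calc ∑ d ∈ 𝒟, ρ d ≤ ∑ d ∈ 𝒟, (B : ℝ) ^ ω d := Finset.sum_le_sum hρB
        _ ≤ ∑ d ∈ Icc 1 Dn', (B : ℝ) ^ ω d :=
            Finset.sum_le_sum_of_subset_of_nonneg hsub𝒟 fun d _ _ => by positivity
        _ ≤ Dn' * Real.exp (2 * B * (Real.log (Real.log Dn') + 5)) :=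
            sum_pow_omega_le (Nat.cast_nonneg B) hDn'2
        _ ≤ Dn' * (Real.exp (10 * B) * Real.exp (2 * B * Real.log L)) :=
            mul_le_mul_of_nonneg_left (hexpw _ (Nat.cast_nonneg B)) (Nat.cast_nonneg _)
        _ = ((Dn' : ℕ) : ℝ) * (Real.exp (10 * B) * L ^ (2 * B)) := by rw [hLpow]
    -- `Dn' ≤ 2 x^{1/4}`, `(log x)^{2B+t+3} ≤ x^{1/2}` and `2 e^{10B} x^{3/4} ≤ x`
    have h16 : (16 : ℝ) ^ (1 / 4 : ℝ) = 2 := by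
      rw [show (16 : ℝ) = 2 ^ (4 : ℝ) by norm_num, ← Real.rpow_mul (by norm_num)]; norm_num
    have hx4 : (2 : ℝ) ≤ x ^ (1 / 4 : ℝ) := by
      rw [← h16]
      exact Real.rpow_le_rpow (by norm_num) hx16' (by norm_num)
    have hDn'le : ((Dn' : ℕ) : ℝ) ≤ 2 * x ^ (1 / 4 : ℝ) := by
      rw [hDn']
      rcases le_total Dn 2 with h | h
      · rw [max_eq_right h]; push_cast; linarith
      · rw [max_eq_left h]; linarith [hDnx4, show (0:ℝ) ≤ x ^ (1 / 4 : ℝ) by positivity]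
    have hlogle' : L ^ (2 * B + t + 3) ≤ x ^ (1 / 2 : ℝ) := by
      have := hlogle
      rwa [Real.rpow_natCast] at this
    have he : 2 * Real.exp (10 * (B : ℝ)) ≤ x ^ (1 / 4 : ℝ) := by
      -- `x ≥ 16 e^{40B}` gives `x^{1/4} ≥ 2 e^{10 B}`
      have h1 : (16 * Real.exp (40 * B)) ^ (1 / 4 : ℝ) = 2 * Real.exp (10 * B) := by
        rw [Real.mul_rpow (by norm_num) (Real.exp_pos _).le, h16, ← Real.exp_mul,
          show (40 : ℝ) * B * (1 / 4) = 10 * B by ring]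
      rw [← h1]
      exact Real.rpow_le_rpow (by positivity) hxe (by norm_num)
    have hx34 : x ^ (1 / 4 : ℝ) * x ^ (1 / 2 : ℝ) * x ^ (1 / 4 : ℝ) = x := by
      rw [← Real.rpow_add hx0, ← Real.rpow_add hx0]; norm_num
    rw [le_div_iff₀ (by positivity)]
    calc (∑ d ∈ 𝒟, ρ d) * L ^ (t + 3) ≤ ((Dn' : ℕ) : ℝ) * (Real.exp (10 * B) * L ^ (2 * B)) * L ^ (t + 3) :=
          mul_le_mul_of_nonneg_right h1 (by positivity)
      _ = ((Dn' : ℕ) : ℝ) * Real.exp (10 * B) * L ^ (2 * B + t + 3) := by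
          rw [pow_add, pow_add]; ring
      _ ≤ (2 * x ^ (1 / 4 : ℝ)) * Real.exp (10 * B) * x ^ (1 / 2 : ℝ) := by
          gcongr
      _ = x ^ (1 / 4 : ℝ) * x ^ (1 / 2 : ℝ) * (2 * Real.exp (10 * B)) := by ring
      _ ≤ x ^ (1 / 4 : ℝ) * x ^ (1 / 2 : ℝ) * x ^ (1 / 4 : ℝ) :=
          mul_le_mul_of_nonneg_left he (by positivity)
      _ = x := hx34
  -- assembly
  have hsplit : ∑ d ∈ 𝒟, ∑ s ∈ rootsMod F d, (1 + |Lam d s|) = ∑ d ∈ 𝒟, ρ d + ∑ d ∈ 𝒟, ∑ s ∈ rootsMod F d, |Lam d s| := by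
    rw [← Finset.sum_add_distrib]
    refine Finset.sum_congr rfl fun d _ => ?_
    rw [Finset.sum_add_distrib, Finset.sum_const, nsmul_eq_mul, mul_one, card_rootsMod]
  have hinner : ∑ d ∈ 𝒟, ∑ s ∈ rootsMod F d, |Lam d s| ≤ ∑ d ∈ 𝒟, ρ d * M d :=
    Finset.sum_le_sum fun d _ => hsst d
  show ∑ d ∈ 𝒟, ∑ s ∈ rootsMod F d, (1 + |Lam d s|) ≤ (c₀ + 1) * x / L ^ (t + 3)
  rw [hsplit]
  calc ∑ d ∈ 𝒟, ρ d + ∑ d ∈ 𝒟, ∑ s ∈ rootsMod F d, |Lam d s|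
      ≤ x / L ^ (t + 3) + c₀ * x / L ^ (t + 3) := add_le_add hIV (hinner.trans hIII)
    _ = (c₀ + 1) * x / L ^ (t + 3) := by ring

end Summit.Parity.GeneralizedHardyLittlewood.Theorems.AbsoluteUpgrade

end
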